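import Summits.PneNP.PneNP.Theses.ConvexRankGates
import Literature.Computability.Complexity.ExtMonotoneCircuits
import Literature.Computability.Complexity.CircuitPlug
import HarnessLib.Audit

/-!
# Line `csp-spine-meet-to-join` — skeleton for crux `ConvexRankGates.Capture` (stmt-PneNP-2659)

Route `route-PneNP-ConvexRankGates`; crux idea card `csp-spine-meet-to-join` (ideator
cruxidea-stmt-PneNP-2659-1, evidence 20260815T224942Z; triage r1: pass ×3 — TRIAGE-r1-1 "lever
checks on paper … genuine, decidable-per-G door test", TRIAGE-r1-2 "honest partial line with the
right cheap experiment built in", TRIAGE-r1-3 "a genuine SPECIAL CASE, not a costume"; all three: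
"state the spine sub-conjecture as the line's statement, make the NONABELIAN coset CSP the first
deliverable, be explicit that the spine does not reach all of monotone P/poly").

Crux (by name): `Summit.PneNP.PneNP.Theses.ConvexRankGates.Capture` — every MONOTONE Boolean
function with a `B₂`-circuit of size `t` on `n` inputs has a circuit with `≤ (t+n+2)^a` gates over
the extended monotone basis `B_S = {∧₂, ∨₂} ∪ CONV_S ∪ PERM_S ∪ GRANK_S`, `S = (t+n+2)^a`
(library name `extGate S`, `Literature/Computability/Complexity/ExtMonotoneGates.lean`).

## The line in one paragraph

The one place in mathematics where a "no third door" theorem EXISTS is the fixed-template CSP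
dichotomy (Bulatov 2017, Zhuk 2020): a finite constraint language is tractable iff it has a Taylor
polymorphism, and every tractable language is solved by gluing three SOLVED STRATA — local
consistency (bounded width = Datalog, Feder–Vardi 1998, Barto–Kozik 2014), linear equations over
the cyclic rings `ℤ/m` ("ability to count", Atserias–Bulatov–Dawar 2009), and Mal'tsev / coset
constraints over finite groups (Feder–Vardi's "subgroup problems", Bulatov–Dalmau 2006). The
unsatisfiability of a SELECTED sub-instance is a monotone polynomial-time function of the selection,
so Capture predicts that each stratum is already inside `B_S`-circuits. This file ADJOINS the three
strata to the basis as wide monotone gates — LC gates (`IsLCGate`: `k`-consistency refutes the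
selected instance), LIN gates (`IsLinGate`: the selected affine system over `ZMod m`, `m ≤ S`, is
unsolvable — the disprover's `ThirdDoor.linUnsat m D` at modulus `≤ S`), COSET gates
(`IsCosetGate`: the selected coset constraints over a finite group `G`, `|G| ≤ S`, have no common
solution) — giving the SPINE basis `spineGate S ⊇ extGate S`, and cuts Capture into
(1) `ConsistencyUnrolls`: every LC gate is a poly-size `{∧₂, ∨₂, 0, 1}`-circuit (monotone Datalog
unrolls into monotone circuits, Afrati–Cosmadakis–Yannakakis 1995; so the whole bounded-width
stratum contributes NO door); (2) `CyclicFredholm`: every LIN gate is a poly-size `{∨₂, 0, 1} ∪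
PERM_{poly(S)}`-circuit (Fredholm alternative over the self-injective ring `ℤ/pᵏ`, CRT, and the
regular embedding `(ℤ/pᵏ)^{D+1} ↪ Sym((D+1)pᵏ)`; the PERM size is polynomial in `m`, NOT in
`log m` — exactly the obstruction `no_zmod_two_pow_embedding` of Disproof §3, so the only escape of
this stratum is a modulus GROWING faster than the size parameter, the refuters' third door);
(3) `CosetMeetToJoin` — THE LEVER AND THE OPEN TEST: every COSET gate over an ARBITRARY finite group
is a poly-size `{∧₂, ∨₂, 0, 1} ∪ PERM_{poly(S)}`-circuit (abelian `G`: one PERM gate by Pontryagin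
duality = "meet-to-join"; nonabelian `G`: no duality is known — a construction proves it, its failure
names a door INSIDE tractable-CSP-land); (4) `CaptureModSpine` — the declared RESIDUAL: Capture with
target basis `spineGate` instead of `extGate` (trivially implied by Capture: `capture_imp_captureModSpine`;
modulo (1)–(3) equivalent to it). `Capture_of : (1) → (2) → (3) → (4) → Capture` is PROVED here by a
gate-by-gate basis simulation (`exists_circuit_of_gateSim`, via `GateList.plug`) and the arithmetic
`((t+n+2)^a + 2)^{c+1} ≤ (t+n+2)^{(a+2)(c+1)}`.

What the cut buys (honestly): (4) is NOT smaller than the crux in any proved sense — this is a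
DOOR-MAP line, not a proof strategy for all of monotone P/poly (the idea card has no transfer from an
arbitrary `B₂`-circuit to CSP form, and none is claimed). Its landings are (1)–(3): kernel-checked
theorems that the three solved strata of the dichotomy add nothing to `B_S` (or, for (3), the first
explicit door candidate that is a TRACTABLE CSP), after which any third door must lie outside the
three solved strata (bounded width, cyclic-affine, coset), not merely outside three gate types.
Whether EVERY tractable (Taylor) template reduces monotonically to these strata — a monotone form of
Zhuk's gluing by absorption, centres and linear quotients — is the line's horizon, deliberately NOT
a stub (Zhuk's algorithm recurses through satisfiability calls, i.e. through negations).

## Shape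

`Capture_of : Registered.stub_consistencyUnrolls → Registered.stub_cyclicFredholm →
Registered.stub_cosetMeetToJoin → Registered.stub_captureModSpine → Capture` concludes the crux BY
NAME; `sorry` occurs only inside the four `stub_*`; the `Registered.stub_*` abbrevs key the stub
STATEMENTS by the stub names (device of `Cruxes/WindowBarrier/Lines/entropy-support-dichotomy.lean`).
Sorry-free besides the composition: monotonicity of the three new gate classes
(`spineGate_monotone`: the spine basis is monotone BY SYNTAX, so the residual keeps the hypothesis
`Monotone f` — `captureModSpine_false_without_monotone`, the analogue of Disproof §1
`capture_false_without_Monotone`), soundness of `k`-consistency refutation (`KInconsistent.sound`: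
an LC gate that fires certifies unsatisfiability), `extGate ⊆ spineGate`,
`capture_imp_captureModSpine`, constants are CONV gates (`isConvGate_const`).
-/

namespace Summit.PneNP.PneNP.Cruxes.Capture.CspSpineMeetToJoin

set_option linter.unusedVariables false
set_option linter.dupNamespace false

open scoped Matrix
open Literature.Computability.Complexity

/-! ## The three solved strata of the CSP dichotomy as monotone gate classes -/

section LC

variable {nv nd k m : ℕ}

/-- **`k`-consistency refutation** (strong `k`-consistency / the existential `k`-pebble game,
Feder–Vardi 1998 §5, Kolaitis–Vardi 2000): CSP variables `Fin nv`, domain `Fin nd`; constraint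
`j` has scope `U j` and allowed set `R j` (a predicate on total assignments depending only on
`U j`), and is PRESENT iff `v j = true`. `KInconsistent U R v W h` says that the partial assignment
`h|_W` (`|W| ≤ k`; total functions represent partial ones) is derivably inconsistent: it violates a
present constraint inside `W` (`viol`), or some further variable admits no consistent value
(`ext`), or it extends an inconsistent sub-assignment (`mono`); `congr` makes the representative
irrelevant. The selected instance is REFUTED iff the empty assignment is inconsistent. -/
inductive KInconsistent (nv nd k : ℕ) {m : ℕ} (U : Fin m → Finset (Fin nv))
    (R : Fin m → (Fin nv → Fin nd) → Prop) (v : Fin m → Bool) :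
    Finset (Fin nv) → (Fin nv → Fin nd) → Prop
  | viol {j : Fin m} {W : Finset (Fin nv)} {h : Fin nv → Fin nd} :
      v j = true → U j ⊆ W → W.card ≤ k → ¬ R j h → KInconsistent nv nd k U R v W h
  | ext {W : Finset (Fin nv)} {h : Fin nv → Fin nd} (x : Fin nv) :
      W.card < k → x ∉ W →
      (∀ a : Fin nd, KInconsistent nv nd k U R v (insert x W) (Function.update h x a)) →
      KInconsistent nv nd k U R v W h
  | mono {W W' : Finset (Fin nv)} {h : Fin nv → Fin nd} :
      W ⊆ W' → W'.card ≤ k → KInconsistent nv nd k U R v W h → KInconsistent nv nd k U R v W' h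
  | congr {W : Finset (Fin nv)} {h h' : Fin nv → Fin nd} :
      (∀ y ∈ W, h' y = h y) → KInconsistent nv nd k U R v W h → KInconsistent nv nd k U R v W h'

/-- `k`-consistency refutation is MONOTONE in the set of present constraints. -/
theorem KInconsistent.mono_sel {U : Fin m → Finset (Fin nv)} {R : Fin m → (Fin nv → Fin nd) → Prop}
    {v w : Fin m → Bool} (hvw : v ≤ w) {W : Finset (Fin nv)} {h : Fin nv → Fin nd}
    (hd : KInconsistent nv nd k U R v W h) : KInconsistent nv nd k U R w W h := by
  induction hd with
  | viol hv hU hW hR => exact .viol (eq_true_of_le_of_eq_true (hvw _) hv) hU hW hR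
  | ext x hW hx _ ih => exact .ext x hW hx ih
  | mono hWW' hW' _ ih => exact .mono hWW' hW' ih
  | congr hh' _ ih => exact .congr hh' ih

/-- **Soundness**: if the allowed sets are scope-determined and `sol` satisfies every present
constraint, then no partial assignment agreeing with `sol` is derivably inconsistent. In particular
a refuted instance has no solution (completeness holds iff the template has width `k` —
Feder–Vardi 1998, Barto–Kozik 2014; not needed here). -/
theorem KInconsistent.sound {U : Fin m → Finset (Fin nv)} {R : Fin m → (Fin nv → Fin nd) → Prop}
    (hR : ∀ j h h', (∀ y ∈ U j, h' y = h y) → (R j h ↔ R j h')) {v : Fin m → Bool}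
    {sol : Fin nv → Fin nd} (hsol : ∀ j, v j = true → R j sol) {W : Finset (Fin nv)}
    {h : Fin nv → Fin nd} (hd : KInconsistent nv nd k U R v W h) :
    (∀ y ∈ W, sol y = h y) → False := by
  induction hd with
  | @viol j W h hv hU hW hRj =>
    intro hag
    exact hRj ((hR j h sol fun y hy => hag y (hU hy)).2 (hsol j hv))
  | @ext W h x hW hx _ ih =>
    intro hag
    refine ih (sol x) fun y hy => ?_
    rcases Finset.mem_insert.1 hy with rfl | hy
    · simp
    · rw [Function.update_of_ne (fun hxy : y = x => hx (hxy ▸ hy))]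
      exact hag y hy
  | mono hWW' _ _ ih => exact fun hag => ih fun y hy => hag y (hWW' hy)
  | congr hh' _ ih => exact fun hag => ih fun y hy => (hag y hy).trans (hh' y hy)

/-- A refuted selected instance (empty assignment inconsistent) has no solution. -/
theorem KInconsistent.unsat {U : Fin m → Finset (Fin nv)} {R : Fin m → (Fin nv → Fin nd) → Prop}
    (hR : ∀ j h h', (∀ y ∈ U j, h' y = h y) → (R j h ↔ R j h')) {v : Fin m → Bool}
    (href : ∀ h, KInconsistent nv nd k U R v ∅ h) :
    ¬ ∃ sol : Fin nv → Fin nd, ∀ j, v j = true → R j sol := by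
  rintro ⟨sol, hsol⟩
  exact (href sol).sound hR hsol fun y hy => absurd hy (Finset.notMem_empty y)

end LC

/-- **LC gates** (local-consistency stratum; size parameter `s`): arity `≤ s`; CSP variables
`Fin nv`, domain `Fin nd`, width `k` with `nv, nd ≤ s` and `(nv·nd + 1)^k ≤ s` (a bound on the
number of `k`-bounded partial assignments = Datalog facts); input `j` selects a constraint of scope
`U j` (`|U j| ≤ k`) with scope-determined allowed set `R j`; the gate FIRES iff `k`-consistency
refutes the selected instance. For a template of bounded width and `k` at least its width this IS
unsatisfiability (Feder–Vardi 1998; Barto–Kozik 2014; the hierarchy collapses to width `(2,3)`,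
Barto 2016); in general it is a sound under-approximation (`KInconsistent.unsat`). -/
def IsLCGate (s : ℕ) (g : GateFn) : Prop :=
  g.1 ≤ s ∧ ∃ nv nd k : ℕ, nv ≤ s ∧ nd ≤ s ∧ (nv * nd + 1) ^ k ≤ s ∧
    ∃ (U : Fin g.1 → Finset (Fin nv)) (R : Fin g.1 → (Fin nv → Fin nd) → Prop),
      (∀ j, (U j).card ≤ k) ∧ (∀ j h h', (∀ y ∈ U j, h' y = h y) → (R j h ↔ R j h')) ∧
      ∀ v : Fin g.1 → Bool, g.2 v = true ↔ ∀ h : Fin nv → Fin nd, KInconsistent nv nd k U R v ∅ h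

/-- **LIN gates** (affine stratum over cyclic rings; size parameter `s`): a modulus `0 < m ≤ s`,
a dimension `D ≤ s`, one affine equation `a j ⬝ᵥ y = b j` over `ZMod m` per input; the gate FIRES
iff the SELECTED system is unsolvable. At `m = 2` this is the route's XOR-UNSAT
(`XorUnsatIsOnePermGate`, Goos–Kamath–Robere–Sokolov 2019); for general `m` it is the disprover's
`ThirdDoor.linUnsat m D` (Disproof §4) — here with `m` bounded by the size parameter. -/
def IsLinGate (s : ℕ) (g : GateFn) : Prop :=
  ∃ m D : ℕ, 0 < m ∧ m ≤ s ∧ D ≤ s ∧ ∃ (a : Fin g.1 → Fin D → ZMod m) (b : Fin g.1 → ZMod m),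
    ∀ v : Fin g.1 → Bool, g.2 v = true ↔ ¬ ∃ y : Fin D → ZMod m, ∀ j, v j = true → a j ⬝ᵥ y = b j

/-- **COSET gates** (Mal'tsev / subgroup stratum, Feder–Vardi 1998 §6, Bulatov–Dalmau 2006; size
parameter `s`): a finite group `G` with `|G| ≤ s` (ANY finite group — abelian and nonabelian), CSP
variables `Fin nv`, `nv ≤ s`, arity `≤ s`; input `j` selects the constraint "the restriction of
`h : Fin nv → G` to the scope of `j` lies in the left coset `c j · H j`" of a subgroup
`H j ≤ G^{r j}` (`|G|^{r j} ≤ s`); the gate FIRES iff the selected constraints have NO common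
solution. Monotone; polynomial-time (coset constraints are preserved by the Mal'tsev operation
`x y⁻¹ z`). NB: cosets, not word equations — equations over a fixed nonabelian group are
NP-complete (Goldmann–Russell 2002). -/
def IsCosetGate (s : ℕ) (g : GateFn) : Prop :=
  g.1 ≤ s ∧ ∃ (G : Type) (_ : Group G) (_ : Fintype G) (nv : ℕ), Fintype.card G ≤ s ∧ nv ≤ s ∧
    ∃ (r : Fin g.1 → ℕ) (scope : (j : Fin g.1) → Fin (r j) → Fin nv)
      (H : (j : Fin g.1) → Subgroup (Fin (r j) → G)) (c : (j : Fin g.1) → Fin (r j) → G),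
      (∀ j, Fintype.card G ^ r j ≤ s) ∧
      ∀ v : Fin g.1 → Bool, g.2 v = true ↔
        ¬ ∃ h : Fin nv → G, ∀ j, v j = true → (c j)⁻¹ * (fun i => h (scope j i)) ∈ H j

/-- The **spine basis** `B_s ∪ LC_s ∪ LIN_s ∪ COSET_s`: the extended monotone basis of route
ConvexRankGates with the three solved strata of the CSP dichotomy adjoined as wide gates. -/
def spineGate (s : ℕ) : Set GateFn :=
  extGate s ∪ {g | IsLCGate s g ∨ IsLinGate s g ∨ IsCosetGate s g}

/-- The small monotone basis with constants `{∧₂, ∨₂, 1, 0}` (target of `ConsistencyUnrolls`). -/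
def monConst : Set GateFn :=
  {GateFn.and 2, GateFn.or 2, GateFn.const true, GateFn.const false}

/-- `{∧₂, ∨₂, 1, 0} ∪ PERM_S` (target of `CyclicFredholm` and `CosetMeetToJoin`). -/
def permBasis (S : ℕ) : Set GateFn :=
  monConst ∪ {g | IsPermGate S g}

/-! ## The four statements -/

/-- (1) **Local consistency unrolls**: an LC gate of size parameter `s` is computed by a
`{∧₂, ∨₂, 1, 0}`-circuit with `≤ (s+2)^c` gates (the `k`-consistency closure is the least fixed
point of a monotone operator on `≤ s` facts, reached in `≤ s` rounds; unroll — Datalog queries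
have polynomial monotone circuits, Afrati–Cosmadakis–Yannakakis 1995). TRUE; size M/L. -/
def ConsistencyUnrolls : Prop :=
  ∃ c : ℕ, ∀ (s : ℕ) (g : GateFn), IsLCGate s g →
    ∃ C : Circuit (Fin g.1), C.IsOver monConst ∧ C.size ≤ (s + 2) ^ c ∧ C.Computes g.2

/-- (2) **Cyclic Fredholm**: a LIN gate of size parameter `s` (modulus `m ≤ s`, dimension `D ≤ s`)
is computed by a `{∧₂, ∨₂, 1, 0} ∪ PERM_{(s+2)^c}`-circuit with `≤ (s+2)^c` gates: by CRT an `∨`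
over the prime powers `pᵏ ∥ m`; over the self-injective ring `ℤ/pᵏ` the selected system is
unsolvable iff `(0,…,0,p^{k-1})` lies in the subgroup of `(ℤ/pᵏ)^{D+1}` generated by the selected
augmented rows (Fredholm alternative), i.e. iff a fixed permutation lies in the subgroup of
`Sym((D+1)·pᵏ)` generated by the selected row-translations (regular embedding) — ONE PERM gate on
`≤ s(s+1)` points. The point count is polynomial in `m`, not in `log m` (Disproof §3
`no_zmod_two_pow_embedding`, triage E3 `prime_pow_le_of_injective_hom`). TRUE; size L. -/
def CyclicFredholm : Prop :=
  ∃ c : ℕ, ∀ (s : ℕ) (g : GateFn), IsLinGate s g →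
    ∃ C : Circuit (Fin g.1), C.IsOver (permBasis ((s + 2) ^ c)) ∧ C.size ≤ (s + 2) ^ c ∧
      C.Computes g.2

/-- (3) **Coset meet-to-join** (THE LEVER; open for nonabelian `G`): a COSET gate of size parameter
`s` is computed by a `{∧₂, ∨₂, 1, 0} ∪ PERM_{(s+2)^c}`-circuit with `≤ (s+2)^c` gates — emptiness of
an intersection of selected cosets (a MEET condition) expressed through membership in generated
subgroups (JOIN conditions). Abelian `G`: true (characters turn coset constraints into a linear
system over `ℤ/exp G`, then (2)). Nonabelian `G` (first cases `S₃`, `Q₈`, then non-solvable): no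
Pontryagin/Fredholm duality; the Feder–Vardi / Bulatov–Dalmau algorithms are sequential
compact-representation computations, not monotone circuits. A proof is a construction; a disproof
exhibits a door that is itself a tractable CSP. -/
def CosetMeetToJoin : Prop :=
  ∃ c : ℕ, ∀ (s : ℕ) (g : GateFn), IsCosetGate s g →
    ∃ C : Circuit (Fin g.1), C.IsOver (permBasis ((s + 2) ^ c)) ∧ C.size ≤ (s + 2) ^ c ∧
      C.Computes g.2

/-- (4) **Capture modulo the spine** (the declared RESIDUAL): `Capture` verbatim with the target
basis enlarged from `extGate` to `spineGate` — a simulating circuit may use, besides CONV / PERM /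
GRANK, the unsatisfiability of any selected bounded-width instance, any selected affine system over
`ℤ/m` (`m ≤ S`) and any selected coset system over a finite group of order `≤ S` as single gates.
Weaker than the crux (`capture_imp_captureModSpine`), equivalent to it modulo (1)–(3); carries the
crux's whole difficulty for functions outside the CSP world. -/
def CaptureModSpine : Prop :=
  ∃ a : ℕ, ∀ (ι : Type) (_ : Fintype ι) (f : (ι → Bool) → Bool), Monotone f →
    ∀ C : Circuit ι, C.IsOver B2 → C.Computes f →
      ∃ C' : Circuit ι, C'.IsOver (spineGate ((C.size + Fintype.card ι + 2) ^ a)) ∧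
        C'.size ≤ (C.size + Fintype.card ι + 2) ^ a ∧ C'.Computes f

/-! ## The four stubs -/

/-- **Stub 1 — `ConsistencyUnrolls`.** Why plausibly true: it IS true (monotone inflationary fixed
point on `≤ (nv·nd+1)^k ≤ s` facts; one round = for each fact an `∨` over present constraints
violated inside its scope (`viol`, wired to the inputs), an `∨` over variables of an `∧` over
values (`ext`), an `∨` over sub-facts (`mono`); `≤ s` rounds; `CktSize.iterate`). Plan: index facts
by `(W, h|_W)` with `W.card ≤ k`; prove the round operator monotone and its `s`-th iterate from `0`
equal to `KInconsistent … ∅`; constants via `GateFn.const`. Size M/L (~400 lines). Leans on: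
`CktSize.{gate,comp,pair,pi,iterate,toCircuit}`, `KInconsistent`. -/
theorem stub_consistencyUnrolls : ConsistencyUnrolls := by
  sorry

/-- **Stub 2 — `CyclicFredholm`.** Why plausibly true: it IS true (see the docstring of
`CyclicFredholm`). Plan: (a) CRT: solvability over `ZMod m` iff over every `ZMod (p^k)`, `p^k ∥ m`
(`ZMod.prodEquivPi` / `Ideal.quotientInfRingEquivPiQuotient`), at most `Nat.log 2 s + 1` disjuncts;
(b) Fredholm over `ℤ/pᵏ`: `¬∃ y, A y = b ↔ (0, p^{k-1}) ∈ AddSubgroup.closure {(a j, b j) | v j}`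
(duality for modules over the self-injective ring `ZMod (p^k)`: a functional killing the selected
rows but not `(0, p^{k-1})` ↔ a solution; cf. the PROVED `zeroOne_mem_span_iff_xorUnsat`,
`Theorems/ConvexRankGatesXorUnsatIsOnePermGate.lean`, which is the case `k = 1`, `p = 2`);
(c) regular embedding `(ZMod (p^k))^{D+1} ↪ Equiv.Perm (Fin (D+1) × ZMod (p^k))` by translations and
`mem_closure_image_iff` (ibid., `mem_closure_image_iff_mem_span` pattern); (d) assemble the `∨` of
`≤ log₂ s + 1` PERM gates of size `≤ s(s+1) ≤ (s+2)^2` with `CktSize`. Size L (~600 lines).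
Leans on: Mathlib `ZMod`, `Subgroup.closure`, `Equiv.Perm`, `Nat.factorization`; tree
`IsPermGate`, the XOR-UNSAT theorem file. -/
theorem stub_cyclicFredholm : CyclicFredholm := by
  sorry

/-- **Stub 3 — `CosetMeetToJoin`** (hardest CLAIMED stub; the idea's door test). Why plausibly
true: for abelian `G` it reduces to Stub 2 (characters of `G^{r}` vanishing on `H j`); for
nonabelian `G` the selected-coset intersection problem is in P uniformly (Feder–Vardi 1998 Thm. 33 /
Bulatov–Dalmau 2006) and monotone, Capture predicts a `B_S`-circuit, and PERM is the only gate type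
of `B_S` that sees group structure; the solvable case may go through the derived series layer by
layer (each layer a LIN-type duality twisted by the action of the quotient), the non-solvable case
is wide open. Why it might fail: nonabelian coset intersection has no join-side dual object; a
universally quantified layer recursion (`∀` solutions of the quotient layer) is exponential, and no
f-independent monotone selector exists (Negative-notes N1). First test cases: `G = S₃` with unary
and binary coset constraints; `G = Q₈`; `G = A₅`. Size XL / open. Leans on: Mathlib `Subgroup`,
`Equiv.Perm`, `QuotientGroup`; tree `IsPermGate`, Stub 2. -/
theorem stub_cosetMeetToJoin : CosetMeetToJoin := by
  sorry

/-- **Stub 4 — `CaptureModSpine`** (RESIDUAL — declared open, NOT claimed easier than the crux).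
It is `Capture` with more target gates, hence implied by `Capture` (`capture_imp_captureModSpine`)
and, given Stubs 1–3, equivalent to it (`Capture_of`). What it localises: after Stubs 1–3 a
counterexample to the crux must be a monotone polynomial-time family that is not expressible by
polynomial-size circuits over CONV, PERM, GRANK AND the unsatisfiability gates of all three solved
strata of the CSP dichotomy (bounded width, affine over `ℤ/m` with `m ≤ S`, cosets over groups of
order `≤ S`) — the refuters' candidate `LIN-UNSAT` over `ℤ/2^{n^ε}` (modulus `> S`) is of this
kind, as are `H`-minor containment and linkless embeddability, and possibly UNSAT of tractable
templates beyond the three strata (the horizon above). No transfer from an arbitrary `B₂`-circuit to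
the spine is known or claimed. Size: the crux. -/
theorem stub_captureModSpine : CaptureModSpine := by
  sorry

/-! ## Name-keyed aliases of the four stub statements (hypotheses of the composition)

`Registered.stub_X : Prop` is the statement of `stub_X` under the registered stub's short name, so
that the native skeleton audit (`#h21_check_skeleton`: hypotheses admissible iff registered
obligations / declared stubs BY NAME) accepts
`Capture_of : Registered.stub_consistencyUnrolls → … → Capture`
(device of `Cruxes/WindowBarrier/Lines/entropy-support-dichotomy.lean`). -/
namespace Registered

/-- Alias of `ConsistencyUnrolls` keyed by the registered stub name. -/
abbrev stub_consistencyUnrolls : Prop := ConsistencyUnrolls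
/-- Alias of `CyclicFredholm` keyed by the registered stub name. -/
abbrev stub_cyclicFredholm : Prop := CyclicFredholm
/-- Alias of `CosetMeetToJoin` keyed by the registered stub name. -/
abbrev stub_cosetMeetToJoin : Prop := CosetMeetToJoin
/-- Alias of `CaptureModSpine` keyed by the registered stub name. -/
abbrev stub_captureModSpine : Prop := CaptureModSpine

end Registered

/-! ## Glue, part 1 (sorry-free): the spine basis is monotone by syntax; constants are CONV gates -/

/-- LC gates are monotone (more present constraints, more refutations). -/
theorem IsLCGate.monotone {s : ℕ} {g : GateFn} (hg : IsLCGate s g) : Monotone g.2 := by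
  obtain ⟨-, nv, nd, k, -, -, -, U, R, -, -, hiff⟩ := hg
  exact monotone_of_forall_iff hiff fun v w hvw hv h => (hv h).mono_sel hvw

/-- LIN gates are monotone (more equations, fewer solutions). -/
theorem IsLinGate.monotone {s : ℕ} {g : GateFn} (hg : IsLinGate s g) : Monotone g.2 := by
  obtain ⟨m, D, -, -, -, a, b, hiff⟩ := hg
  refine monotone_of_forall_iff hiff fun v w hvw hv ⟨y, hy⟩ => hv ⟨y, fun j hj => ?_⟩
  exact hy j (eq_true_of_le_of_eq_true (hvw j) hj)

/-- COSET gates are monotone (more coset constraints, fewer common solutions). -/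
theorem IsCosetGate.monotone {s : ℕ} {g : GateFn} (hg : IsCosetGate s g) : Monotone g.2 := by
  obtain ⟨-, G, _, _, nv, -, -, r, scope, H, c, -, hiff⟩ := hg
  refine monotone_of_forall_iff hiff fun v w hvw hv ⟨h, hh⟩ => hv ⟨h, fun j hj => ?_⟩
  exact hh j (eq_true_of_le_of_eq_true (hvw j) hj)

/-- `B_s ⊆ spineGate s`. -/
theorem extGate_subset_spineGate (s : ℕ) : extGate s ⊆ spineGate s :=
  Set.subset_union_left

/-- **Every gate of the spine basis computes a monotone Boolean function** — the enlarged model is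
still monotone by syntax. -/
theorem spineGate_monotone {s : ℕ} {g : GateFn} (hg : g ∈ spineGate s) : Monotone g.2 := by
  rcases hg with hg | hg | hg | hg
  · exact extGate_monotone hg
  · exact hg.monotone
  · exact hg.monotone
  · exact hg.monotone

/-- Hence every circuit over the spine basis computes a monotone function. -/
theorem monotone_eval_of_isOver_spineGate {ι : Type*} {s : ℕ} (C : Circuit ι)
    (hC : C.IsOver (spineGate s)) : Monotone C.eval :=
  Circuit.monotone_eval_of_isOver (fun _ hg => spineGate_monotone hg) C hC

/-- **The residual keeps the hypothesis `Monotone f`** (analogue of Disproof §1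
`capture_false_without_Monotone`): dropping it makes `CaptureModSpine` false — `x ↦ ¬x₀` has a
`B₂`-circuit of size `1` and no circuit over any spine basis. -/
theorem captureModSpine_false_without_monotone :
    ¬ ∃ a : ℕ, ∀ (ι : Type) (_ : Fintype ι) (f : (ι → Bool) → Bool),
      ∀ C : Circuit ι, C.IsOver B2 → C.Computes f →
        ∃ C' : Circuit ι, C'.IsOver (spineGate ((C.size + Fintype.card ι + 2) ^ a)) ∧
          C'.size ≤ (C.size + Fintype.card ι + 2) ^ a ∧ C'.Computes f := by
  rintro ⟨a, h⟩
  -- the `B₂`-circuit `¬ x₀` on one variable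
  obtain ⟨C, hCB, -, hCev⟩ := (cktSize_not (ι := Fin 1) (0 : Fin 1)).toCircuit
  obtain ⟨C', hC'over, -, hC'comp⟩ := h (Fin 1) inferInstance (fun x => !(x 0)) C hCB
    (fun x => hCev x)
  have hmono : Monotone (fun x : Fin 1 → Bool => !(x 0)) := by
    intro x y hxy
    rw [← hC'comp x, ← hC'comp y]
    exact monotone_eval_of_isOver_spineGate C' hC'over hxy
  exact not_monotone_bnot_apply (0 : Fin 1) hmono

/-- **The residual is WEAKER than the crux**: `Capture → CaptureModSpine` (same circuit; `B_S` is
part of the spine basis). So Stub 4 is not a strengthening in costume; with Stubs 1–3 it is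
equivalent to the crux (`Capture_of`). -/
theorem capture_imp_captureModSpine
    (hCap : Summit.PneNP.PneNP.Theses.ConvexRankGates.Capture) : CaptureModSpine := by
  obtain ⟨a, hcap⟩ := hCap
  refine ⟨a, fun ι _ f hf C hB2 hcomp => ?_⟩
  obtain ⟨C', hover, hsize, hcomp'⟩ := hcap ι inferInstance f hf C hB2 hcomp
  refine ⟨C', fun g hg => extGate_subset_spineGate _ (mem_extGate_iff.2 ?_), hsize, hcomp'⟩
  exact hover g hg

/-- The constant gates are CONV gates: `1` with no constraint (`p = q = 0`), `0` with the single
infeasible constraint `0 ≤ -1` (`p = 1`, `q = 0`) (refuter route-review 12:19Z on the item). -/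
theorem isConvGate_const (b : Bool) : IsConvGate 1 (GateFn.const b) := by
  cases b
  · refine ⟨1, 0, le_rfl, fun _ => 0, fun _ => -1, fun _ _ => 0, fun _ _ => le_rfl, fun v => ?_⟩
    show false = true ↔ _
    simp only [Bool.false_eq_true, false_iff, not_exists, not_and, not_forall, not_le]
    intro Y _
    refine ⟨0, ?_⟩
    simp
  · refine ⟨0, 0, zero_le_one, fun _ => 0, fun _ => 0, fun _ _ => 0, fun _ _ => le_rfl, fun v => ?_⟩
    show true = true ↔ _
    simp only [true_iff]
    exact ⟨0, Matrix.PosSemidef.zero, fun i => i.elim0⟩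

/-- `{∧₂, ∨₂, 1, 0} ⊆ B_S` for `1 ≤ S`. -/
theorem monConst_subset_extGate {S : ℕ} (hS : 1 ≤ S) : monConst ⊆ extGate S := by
  intro g hg
  simp only [monConst, Set.mem_insert_iff, Set.mem_singleton_iff] at hg
  rcases hg with rfl | rfl | rfl | rfl
  · exact and_mem_extGate S
  · exact or_mem_extGate S
  · exact ((isConvGate_const true).mono hS).mem_extGate
  · exact ((isConvGate_const false).mono hS).mem_extGate

/-- `{∧₂, ∨₂, 1, 0} ∪ PERM_S ⊆ B_S` for `1 ≤ S`. -/
theorem permBasis_subset_extGate {S : ℕ} (hS : 1 ≤ S) : permBasis S ⊆ extGate S := by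
  rintro g (hg | hg)
  · exact monConst_subset_extGate hS hg
  · exact IsPermGate.mem_extGate hg

/-! ## Glue, part 2 (sorry-free): gate-by-gate basis simulation via `GateList.plug` -/

section GateSim

open GateList

variable {ι : Type*}

/-- Relocating an old wire: inputs stay, old gate `m` now lives at `τ m`. -/
def relWire (τ : ℕ → ι ⊕ ℕ) : ι ⊕ ℕ → ι ⊕ ℕ
  | .inl i => .inl i
  | .inr m => τ m

/-- Simulation invariant after translating the prefix `gs`: the new program `P` is well formed,
over `B`, has `≤ M·|gs|` gates, and old gate `m` is carried by the wire `τ m`. -/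
structure SimInv (B : Set GateFn) (M : ℕ) (gs : List (Gate ι)) (P : List (Gate ι))
    (τ : ℕ → ι ⊕ ℕ) : Prop where
  wf : WF P
  isOver : ∀ g ∈ P, g.fn ∈ B
  len : P.length ≤ M * gs.length
  carries : ∃ d, ∀ m, m < gs.length →
    Carries P (τ m) (fun x => wireOf x (vals gs x) (.inr m)) d

/-- Under the invariant every valid old wire is carried by its relocation. -/
theorem SimInv.carries_relWire {B : Set GateFn} {M : ℕ} {gs P : List (Gate ι)} {τ : ℕ → ι ⊕ ℕ}
    (hI : SimInv B M gs P τ) : ∃ d, ∀ w : ι ⊕ ℕ, OutOK gs.length w →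
      Carries P (relWire τ w) (fun x => wireOf x (vals gs x) w) d := by
  obtain ⟨d, hd⟩ := hI.carries
  refine ⟨d, fun w hw => ?_⟩
  cases w with
  | inl i => exact (carries_input P i).mono (Nat.zero_le d)
  | inr m => exact hd m (hw m rfl)

/-- One simulation step: plug the simulating circuit of the next gate behind the program. -/
theorem SimInv.snoc {B : Set GateFn} {M : ℕ} {gs P : List (Gate ι)} {τ : ℕ → ι ⊕ ℕ}
    (hI : SimInv B M gs P τ) (g : Gate ι) (hg : GateOK gs.length g) (A : Circuit (Fin g.arity))
    (hAB : A.IsOver B) (hAs : A.size ≤ M) (hAev : ∀ y, A.eval y = g.op y) :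
    ∃ P' τ', SimInv B M (gs ++ [g]) P' τ' := by
  obtain ⟨d, hd⟩ := hI.carries_relWire
  set ρ : Fin g.arity → ι ⊕ ℕ := fun a => relWire τ (g.args a) with hρ
  have hρc : ∀ a, Carries P (ρ a) (fun x => wireOf x (vals gs x) (g.args a)) d :=
    fun a => hd (g.args a) fun m hm => hg a m hm
  have hρok : WiresOK P.length ρ := fun a => (hρc a).outOK
  refine ⟨(plug P ρ A).1, fun m => if m = gs.length then (plug P ρ A).2 else τ m,
    ⟨wf_plug hI.wf hρok A, fn_mem_plug hI.isOver ρ hAB, ?_, ⟨A.acDepth + d, fun m hm => ?_⟩⟩⟩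
  · rw [length_plug, List.length_append, List.length_singleton, Nat.mul_succ]
    exact Nat.add_le_add hI.len hAs
  · rw [List.length_append, List.length_singleton] at hm
    by_cases hmL : m = gs.length
    · subst hmL
      rw [if_pos rfl]
      refine (carries_plug A hρc).congr fun x => ?_
      rw [hAev, wireOf_inr, vals_append_singleton, List.getD_eq_getElem?_getD,
        List.getElem?_append_right (by simp), length_vals, Nat.sub_self]
      simp
    · rw [if_neg hmL]
      have hm' : m < gs.length := by omega
      have hc : Carries P (τ m) (fun x => wireOf x (vals gs x) (.inr m)) d :=
        hd (.inr m) fun m' hm'' => by cases hm''; exact hm'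
      refine ((hc.plug ρ A).mono (Nat.le_add_left d A.acDepth)).congr fun x => ?_
      exact (wireOf_append_left x gs [g] (o := .inr m) fun m' hm'' => by
        cases hm''; exact hm').symm

/-- **Gate-by-gate basis simulation.** If every gate function of the basis `B'` is computed by a
`B`-circuit with at most `M` gates, then every `B'`-circuit `C` is simulated by a `B`-circuit with
at most `M · |C|` gates (Vollmer 1999, §1.2: plug the simulating circuit of each gate behind the
translated prefix, `GateList.plug`). [folklore] -/
theorem exists_circuit_of_gateSim {B B' : Set GateFn} {M : ℕ}
    (hsim : ∀ g : GateFn, g ∈ B' →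
      ∃ A : Circuit (Fin g.1), A.IsOver B ∧ A.size ≤ M ∧ A.Computes g.2)
    (C : Circuit ι) (hC : C.IsOver B') :
    ∃ C' : Circuit ι, C'.IsOver B ∧ C'.size ≤ M * C.size ∧ ∀ x, C'.eval x = C.eval x := by
  have key : ∀ gs : List (Gate ι), WF gs → (∀ g ∈ gs, g.fn ∈ B') →
      ∃ P τ, SimInv B M gs P τ := by
    intro gs
    induction gs using List.reverseRecOn with
    | nil =>
      intro _ _
      exact ⟨[], fun _ => .inr 0,
        ⟨WF.nil, fun g hg => by simp at hg, by simp, ⟨0, fun m hm => by simp at hm⟩⟩⟩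
    | append_singleton gs g ih =>
      intro hwf hB'
      obtain ⟨P, τ, hI⟩ :=
        ih hwf.of_append_left fun g' hg' => hB' g' (List.mem_append_left _ hg')
      obtain ⟨A, hAB, hAs, hAev⟩ := hsim g.fn (hB' g (by simp))
      exact hI.snoc g hwf.getLast A hAB hAs hAev
  obtain ⟨P, τ, hI⟩ := key C.gates (wf_gates C) hC
  obtain ⟨d, hd⟩ := hI.carries_relWire
  have hout : Carries P (relWire τ C.output) (fun x => wireOf x (vals C.gates x) C.output) d :=
    hd C.output C.wf_output
  refine ⟨toCircuit P (relWire τ C.output) hI.wf hout.outOK,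
    isOver_toCircuit hI.wf hout.outOK hI.isOver, ?_, fun x => ?_⟩
  · rw [size_toCircuit]
    exact hI.len
  · rw [eval_toCircuit hI.wf hout, circuit_eval]

end GateSim


/-! ## The composition: `Capture` from the four stubs (sorry-free) -/

/-- **`Capture` from the four stubs** (concludes the crux BY NAME). From Stubs 1–3 every spine
gate of parameter `S` is an `extGate ((S+2)^c)`-circuit with `≤ (S+2)^c` gates (`c = c₁+c₂+c₃+1`;
extended gates are their own one-gate circuits); Stub 4 turns the `B₂`-circuit of a monotone `f`
into a spine circuit of size `≤ S = (t+n+2)^a`; the gate-by-gate simulation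
(`exists_circuit_of_gateSim`) gives an extended circuit with `≤ (S+2)^c · S ≤ (S+2)^{c+1} ≤
(t+n+2)^{(a+2)(c+1)}` gates over `extGate ((S+2)^c) ⊆ extGate ((t+n+2)^{(a+2)(c+1)})`, which is
the crux with exponent `(a+2)(c+1)` (its inline `Ext` is `extGate` up to unfolding). -/
theorem Capture_of (h₁ : Registered.stub_consistencyUnrolls) (h₂ : Registered.stub_cyclicFredholm)
    (h₃ : Registered.stub_cosetMeetToJoin) (h₄ : Registered.stub_captureModSpine) :
    Summit.PneNP.PneNP.Theses.ConvexRankGates.Capture := by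
  obtain ⟨c₁, h₁⟩ := h₁
  obtain ⟨c₂, h₂⟩ := h₂
  obtain ⟨c₃, h₃⟩ := h₃
  obtain ⟨a, h₄⟩ := h₄
  set c : ℕ := c₁ + c₂ + c₃ + 1 with hc
  -- every spine gate of parameter `S` is an extended circuit of parameter and size `(S+2)^c`
  have hsim : ∀ S : ℕ, ∀ g : GateFn, g ∈ spineGate S → ∃ A : Circuit (Fin g.1),
      A.IsOver (extGate ((S + 2) ^ c)) ∧ A.size ≤ (S + 2) ^ c ∧ A.Computes g.2 := by
    intro S g hg
    have h2 : 1 ≤ S + 2 := by omega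
    have hS1 : 1 ≤ (S + 2) ^ c := Nat.one_le_pow _ _ (by omega)
    have hSc : S ≤ (S + 2) ^ c :=
      (Nat.le_add_right S 2).trans (by simpa using Nat.pow_le_pow_right h2 (by omega : 1 ≤ c))
    have hpow : ∀ e : ℕ, e ≤ c → (S + 2) ^ e ≤ (S + 2) ^ c := fun e he =>
      Nat.pow_le_pow_right h2 he
    have hpow1 : ∀ e : ℕ, 1 ≤ (S + 2) ^ e := fun e => Nat.one_le_pow _ _ (by omega)
    rcases hg with hg | hg | hg | hg
    · obtain ⟨A, hAB, hAs, hAev⟩ := (CktSize.gate (ι := Fin g.1) g hg id).toCircuit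
      exact ⟨A, hAB.mono (extGate_mono hSc), hAs.trans hS1, fun y => hAev y⟩
    · obtain ⟨A, hAB, hAs, hAc⟩ := h₁ S g hg
      exact ⟨A, hAB.mono (monConst_subset_extGate hS1), hAs.trans (hpow c₁ (by omega)), hAc⟩
    · obtain ⟨A, hAB, hAs, hAc⟩ := h₂ S g hg
      exact ⟨A, hAB.mono ((permBasis_subset_extGate (hpow1 c₂)).trans
        (extGate_mono (hpow c₂ (by omega)))), hAs.trans (hpow c₂ (by omega)), hAc⟩
    · obtain ⟨A, hAB, hAs, hAc⟩ := h₃ S g hg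
      exact ⟨A, hAB.mono ((permBasis_subset_extGate (hpow1 c₃)).trans
        (extGate_mono (hpow c₃ (by omega)))), hAs.trans (hpow c₃ (by omega)), hAc⟩
  -- the crux, with exponent `(a+2)(c+1)`
  unfold Summit.PneNP.PneNP.Theses.ConvexRankGates.Capture
  dsimp only
  refine ⟨(a + 2) * (c + 1), fun ι _ f hf C hB2 hcomp => ?_⟩
  obtain ⟨C', hC'over, hC'size, hC'comp⟩ := h₄ ι inferInstance f hf C hB2 hcomp
  set N : ℕ := C.size + Fintype.card ι + 2 with hN
  set S : ℕ := N ^ a with hS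
  obtain ⟨C'', hover'', hsize'', hev''⟩ := exists_circuit_of_gateSim (hsim S) C' hC'over
  -- arithmetic: `(S+2)^(c+1) ≤ N^((a+2)(c+1))`
  have hN2 : 2 ≤ N := by omega
  have h4 : 2 ^ 2 ≤ N ^ 2 := Nat.pow_le_pow_left hN2 2
  have hS2 : S + 2 ≤ N ^ (a + 2) :=
    calc S + 2 ≤ 2 ^ 2 * S := by
          have hS1 : 1 ≤ S := Nat.one_le_pow _ _ (by omega)
          omega
      _ ≤ N ^ 2 * S := Nat.mul_le_mul_right _ h4
      _ = N ^ (a + 2) := by rw [hS]; ring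
  have hbound : (S + 2) ^ (c + 1) ≤ N ^ ((a + 2) * (c + 1)) := by
    rw [pow_mul]
    exact Nat.pow_le_pow_left hS2 _
  have hbound' : (S + 2) ^ c ≤ N ^ ((a + 2) * (c + 1)) :=
    (Nat.pow_le_pow_right (by omega) (Nat.le_succ c)).trans hbound
  refine ⟨C'', fun g hg => mem_extGate_iff.1 (extGate_mono hbound' (hover'' g hg)), ?_,
    fun x => (hev'' x).trans (hC'comp x)⟩
  calc C''.size ≤ (S + 2) ^ c * C'.size := hsize''
    _ ≤ (S + 2) ^ c * (S + 2) := Nat.mul_le_mul_left _ (hC'size.trans (Nat.le_add_right S 2))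
    _ = (S + 2) ^ (c + 1) := (pow_succ _ _).symm
    _ ≤ N ^ ((a + 2) * (c + 1)) := hbound

/-- Wiring check: the registered stubs feed `Capture_of` as stated (sorries only via the stubs). -/
example : Summit.PneNP.PneNP.Theses.ConvexRankGates.Capture :=
  Capture_of stub_consistencyUnrolls stub_cyclicFredholm stub_cosetMeetToJoin stub_captureModSpine

end Summit.PneNP.PneNP.Cruxes.Capture.CspSpineMeetToJoin
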